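import Summits.HubbardSuperconductivity.HubbardSuperconductivity.Theorems.KLProgrammeKLRegimeScaleZeroCovarianceKernelFreqRegularity
import Summits.HubbardSuperconductivity.HubbardSuperconductivity.Theorems.KLProgrammeScaleZeroCovarianceMomentumJetsTab

/-!
# Route `KLProgramme`, crux K3 — engine-flow child (stmt-HubbardSuperconductivity-20437), stub (C) at `n = 0`, located item #22a «(C)-SCALE0-PT2»,
# JOINT FREQUENCY–MOMENTUM JETS: the `N`-th frequency derivative of the UV symbol read along the band, `y ↦ ∂_ωᴺΨ(ω, e_K(2πy))`, has momentum jets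
# `O(m(ω)^{-N-2})` (orders `≥ 1`) — the first brick of the weighted `a`-sizes «A-SIZES-WEIGHTED» and of the analytic `V_N(x̃)` of the β-layer

Cell gate-hubbard-kl, seat p1 g20.  The `N`-th frequency derivative of the joint symbol `Ψ₂ = uvSymbol₂ c Λ` is written WITHOUT a definition as the
`N`-th iterate of the operator `T φ := x ↦ Dφ(x)(e₀)` (`e₀ = fbE0`, the frequency direction): `Tᴺ Ψ₂`.

* §1 (generic, any smooth `f : FreqBand → ℂ`) `contDiff_iterate_freqDeriv`, **`norm_iteratedFDeriv_iterate_freqDeriv_le`** — `‖Dⁱ(Tᴺf)(x)‖ ≤ ‖D^{N+i}f(x)‖`;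
  `hasDerivAt_comp_fbPt`, **`iteratedDeriv_comp_fbPt_eq_iterate_freqDeriv`** — `iteratedDeriv N (ω ↦ f(ω,e)) ω = (Tᴺf)(ω,e)` (the frequency line);
  `norm_iteratedFDeriv_comp_band_le_of_one_le` — value-free Faà di Bruno for `p ↦ h(fbPt ω (u p))`, ANY smooth outer `h`
  (generalises `…MomentumJets.norm_iteratedFDeriv_uvSymbol₂_comp_band_le_of_one_le`);
* §2 (the UV symbol) **`norm_iteratedFDeriv_iterate_freqDeriv_uvSymbol₂_le`** — `‖Dⁱ(TᴺΨ₂)(x)‖ ≤ c·B·(N+i+1)!·(2/m(x₀))^{N+i+1}`;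
  **`norm_iteratedDeriv_freq_uvSymbolFn_le'`** (restated), **`norm_iteratedFDeriv_freqDeriv_uvSpatialSymbol_le_of_one_le`** — for `n ≥ 1`:
  `‖Dⁿ_y [(TᴺΨ₂)(ω, e_K(2πy))]‖ ≤ n!·(c·B·(N+n+1)!·(2/m(ω))^{N+2}·max(1,2/m(ω))^{n−1})·(2π·D_K)ⁿ`, and the value
  `‖(TᴺΨ₂)(ω, e)‖ ≤ c·B·(N+1)!·(2/m(ω))^{N+1}`; bare-frame (`D_K = 4`) and table (`B = klChi2CauchyTab (N+n)`) corollaries.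

Consumers (next bricks): `∂_ωᴺ` of the torus spatial factor and of the lattice kernel `a_ω(z)` are the momentum sums / Fourier coefficients of THIS spatial
function (`iteratedDeriv_fun_sum`, `iteratedDeriv_mFourierCoeff_of_isSmoothSpaceTimeOn`), so `…TorusPeriodisation`/`SampledSmoothSymbolPeriodisation`
give `‖∂_ωᴺ TFI¹_ω(z̄)‖, ‖∂_ωᴺ a_ω(z)‖ ≤ D_{N,n}(ω)·(1+‖z‖)⁻ⁿ` with `D_{N,n}(ω) = O(m(ω)^{−N−2})` — joint space–time decay of the `β = ∞` kernel.

Proofs only; no definitions; nothing here asserts (C), any stub of 20437, K3 or superconductivity.  References: BGM 2006 §2.2 (2.36aa), §3 (3.2)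
[cite: BenfattoGiulianiMastropietro2006].
-/

noncomputable section

namespace Summit.HubbardSuperconductivity.HubbardSuperconductivity.Theorems.KLRegimeSplit

set_option linter.dupNamespace false -- summit = problem name (single-conjunct summit), D-0017

open Literature.MathematicalPhysics.QuantumLattice Literature.Probability.LatticeModels Literature.Analysis.FunctionSpaces
open Summit.HubbardSuperconductivity.HubbardSuperconductivity.Theorems.DispersionFlow
open Summit.HubbardSuperconductivity.HubbardSuperconductivity.Theorems.EngineV8 (contDiff_frameLevel norm_iteratedFDeriv_frameLevel_zero_le)
open Finset Complex Real
open scoped ContDiff Nat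

/-! ## §1 The frequency-derivative iterate `Tᴺf`, `T φ = x ↦ Dφ(x)(e₀)` -/

section Generic

variable {f : FreqBand → ℂ}

/-- `Tᴺ f` is smooth when `f` is. -/
theorem contDiff_iterate_freqDeriv (hf : ContDiff ℝ ∞ f) (N : ℕ) :
    ContDiff ℝ ∞ ((fun (ψ : FreqBand → ℂ) => fun x => fderiv ℝ ψ x fbE0)^[N] f) := by
  induction N with
  | zero => exact hf
  | succ N ih =>
    rw [Function.iterate_succ_apply']
    exact (ih.fderiv_right (m := ∞) le_rfl).clm_apply contDiff_const

/-- **`‖Dⁱ(Tᴺ f)(x)‖ ≤ ‖D^{N+i} f(x)‖`** (`‖e₀‖ = 1`). -/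
theorem norm_iteratedFDeriv_iterate_freqDeriv_le (hf : ContDiff ℝ ∞ f) (N i : ℕ) (x : FreqBand) :
    ‖iteratedFDeriv ℝ i ((fun (ψ : FreqBand → ℂ) => fun x => fderiv ℝ ψ x fbE0)^[N] f) x‖ ≤ ‖iteratedFDeriv ℝ (N + i) f x‖ := by
  induction N generalizing i with
  | zero => rw [Nat.zero_add]; simp only [Function.iterate_zero, id_eq, le_refl]
  | succ N ih =>
    rw [Function.iterate_succ_apply']
    have hg := contDiff_iterate_freqDeriv hf N
    have h1 : ‖iteratedFDeriv ℝ i (fun x => fderiv ℝ ((fun (ψ : FreqBand → ℂ) => fun x => fderiv ℝ ψ x fbE0)^[N] f) x fbE0) x‖ ≤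
        ‖fbE0‖ * ‖iteratedFDeriv ℝ i (fderiv ℝ ((fun (ψ : FreqBand → ℂ) => fun x => fderiv ℝ ψ x fbE0)^[N] f)) x‖ :=
      norm_iteratedFDeriv_clm_apply_const ((hg.fderiv_right (m := ∞) le_rfl).contDiffAt) (by exact_mod_cast le_top)
    rw [norm_fbE0, one_mul, norm_iteratedFDeriv_fderiv] at h1
    refine h1.trans ?_
    have h2 := ih (i + 1)
    rwa [show N + (i + 1) = N + 1 + i by ring] at h2

/-- The frequency line through the band value `e` has velocity `e₀`: `d/dω fbPt ω e = e₀`. -/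
theorem hasDerivAt_fbPt (e om : ℝ) : HasDerivAt (fun om : ℝ => fbPt om e) fbE0 om := by
  have h : (fun om : ℝ => fbPt om e) = fun om : ℝ => om • fbE0 + e • fbE1 := by funext om; rfl
  rw [h]
  simpa using ((hasDerivAt_id om).smul_const fbE0).add_const (e • fbE1)

/-- Along the frequency line, `d/dω g(ω, e) = (T g)(ω, e)` for differentiable `g`. -/
theorem hasDerivAt_comp_fbPt {g : FreqBand → ℂ} (hg : Differentiable ℝ g) (e om : ℝ) :
    HasDerivAt (fun om : ℝ => g (fbPt om e)) (fderiv ℝ g (fbPt om e) fbE0) om := by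
  have h := (hg (fbPt om e)).hasFDerivAt.comp_hasDerivAt om (hasDerivAt_fbPt e om)
  exact h

/-- **The `N`-th frequency derivative along the line is the iterate**: `iteratedDeriv N (ω ↦ f(ω, e)) ω = (Tᴺ f)(ω, e)` for smooth `f`. -/
theorem iteratedDeriv_comp_fbPt_eq_iterate_freqDeriv (hf : ContDiff ℝ ∞ f) (N : ℕ) (e om : ℝ) :
    iteratedDeriv N (fun om : ℝ => f (fbPt om e)) om = ((fun (ψ : FreqBand → ℂ) => fun x => fderiv ℝ ψ x fbE0)^[N] f) (fbPt om e) := by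
  induction N generalizing om with
  | zero => simp
  | succ N ih =>
    rw [iteratedDeriv_succ, Function.iterate_succ_apply']
    have hfun : iteratedDeriv N (fun om : ℝ => f (fbPt om e)) =
        fun om : ℝ => ((fun (ψ : FreqBand → ℂ) => fun x => fderiv ℝ ψ x fbE0)^[N] f) (fbPt om e) := funext ih
    rw [hfun]
    exact (hasDerivAt_comp_fbPt ((contDiff_iterate_freqDeriv hf N).differentiable (by simp)) e om).deriv

/-- **Value-free Faà di Bruno for `p ↦ h(ω, u(p))`, any smooth outer `h`**: for `n ≥ 1`, `‖Dⁿ(h(fbPt ω (u ·)))(p)‖ ≤ n!·C·Dⁿ` when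
`‖Dⁱh(fbPt ω (u p))‖ ≤ C` for `1 ≤ i ≤ n` and `‖Dⁱu(p)‖ ≤ Dⁱ` for `1 ≤ i ≤ n`. -/
theorem norm_iteratedFDeriv_comp_band_le_of_one_le {V : Type*} [NormedAddCommGroup V] [NormedSpace ℝ V] {h : FreqBand → ℂ} (hh : ContDiff ℝ ∞ h)
    {n : ℕ} (hn1 : 1 ≤ n) {u : V → ℝ} (hu : ContDiff ℝ n u) (om : ℝ) (p : V) {C D : ℝ}
    (hC : ∀ i, 1 ≤ i → i ≤ n → ‖iteratedFDeriv ℝ i h (fbPt om (u p))‖ ≤ C) (hD : ∀ i, 1 ≤ i → i ≤ n → ‖iteratedFDeriv ℝ i u p‖ ≤ D ^ i) :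
    ‖iteratedFDeriv ℝ n (fun p => h (fbPt om (u p))) p‖ ≤ n ! * C * D ^ n :=
  norm_iteratedFDeriv_comp_le_of_one_le (g := h) (f := fun p => fbPt om (u p)) (N := (n : WithTop ℕ∞)) (hh.of_le (by exact_mod_cast le_top))
    (contDiff_fbPt_comp hu om) le_rfl hn1 p hC (fun i hi1 hin => by
      rw [norm_iteratedFDeriv_fbPt_comp hi1 (hu.of_le (by exact_mod_cast hin)) om p]; exact hD i hi1 hin)

end Generic

/-! ## §2 The UV symbol: jets of `TᴺΨ₂` and of its spatial function -/

/-- **Jets of the `N`-th frequency derivative of the joint symbol**: `‖Dⁱ(TᴺΨ₂)(x)‖ ≤ c·B·(N+i+1)!·(2/m(x₀))^{N+i+1}` (`m(x₀) = max(|x₀|, Λ/2)`;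
table `|χ₂^{(j)}| ≤ B` for `j ≤ N+i`, `B ≥ 1`, `0 ≤ c`, `0 < Λ`). -/
theorem norm_iteratedFDeriv_iterate_freqDeriv_uvSymbol₂_le {c Λ : ℝ} (hc : 0 ≤ c) (hΛ : 0 < Λ) (N i : ℕ) {B : ℝ} (hB1 : 1 ≤ B)
    (hB : ∀ j ≤ N + i, ∀ t, ‖iteratedDeriv j salmhoferCutoff t‖ ≤ B) (x : FreqBand) :
    ‖iteratedFDeriv ℝ i ((fun (ψ : FreqBand → ℂ) => fun x => fderiv ℝ ψ x fbE0)^[N] (uvSymbol₂ c Λ)) x‖ ≤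
      c * B * (N + i + 1) ! * (2 / max |x 0| (Λ / 2)) ^ (N + i + 1) := by
  refine (norm_iteratedFDeriv_iterate_freqDeriv_le (contDiff_uvSymbol₂ c hΛ) N i x).trans ?_
  have h := norm_iteratedFDeriv_uvSymbol₂_le hc hΛ hB1 hB le_rfl x
  exact_mod_cast h

/-- **The value along the band**: `‖(TᴺΨ₂)(ω, e)‖ ≤ c·B·(N+1)!·(2/m(ω))^{N+1}` for every `e`. -/
theorem norm_iterate_freqDeriv_uvSymbol₂_fbPt_le {c Λ : ℝ} (hc : 0 ≤ c) (hΛ : 0 < Λ) (N : ℕ) {B : ℝ} (hB1 : 1 ≤ B)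
    (hB : ∀ j ≤ N, ∀ t, ‖iteratedDeriv j salmhoferCutoff t‖ ≤ B) (om e : ℝ) :
    ‖((fun (ψ : FreqBand → ℂ) => fun x => fderiv ℝ ψ x fbE0)^[N] (uvSymbol₂ c Λ)) (fbPt om e)‖ ≤ c * B * (N + 1) ! * (2 / max |om| (Λ / 2)) ^ (N + 1) := by
  have h := norm_iteratedFDeriv_iterate_freqDeriv_uvSymbol₂_le hc hΛ N 0 hB1 (by simpa using hB) (fbPt om e)
  rw [norm_iteratedFDeriv_zero, fbPt_apply_zero] at h
  simpa using h

/-- **Momentum jets of the `N`-th frequency derivative of the spatial symbol** (`n ≥ 1`): with the cutoff table up to order `N+n` and band jets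
`‖Dⁱe_K‖ ≤ D_Kⁱ` (`1 ≤ i ≤ n`), at every `y`:
`‖Dⁿ_y [(TᴺΨ₂)(ω, e_K(2πy))]‖ ≤ n!·(c·B·(N+n+1)!·(2/m(ω))^{N+2}·max(1,2/m(ω))^{n−1})·(2π·D_K)ⁿ`. -/
theorem norm_iteratedFDeriv_freqDeriv_uvSpatialSymbol_le_of_one_le {c Λ : ℝ} (hc : 0 ≤ c) (hΛ : 0 < Λ) (μ : ℝ) (K : TrigPolyC4v) (om : ℝ)
    (N : ℕ) {n : ℕ} (hn1 : 1 ≤ n) {B : ℝ} (hB1 : 1 ≤ B) (hB : ∀ j ≤ N + n, ∀ t, ‖iteratedDeriv j salmhoferCutoff t‖ ≤ B) {DK : ℝ}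
    (hK : ∀ i : ℕ, 1 ≤ i → i ≤ n → ∀ q : Momentum, ‖iteratedFDeriv ℝ i (frameLevel μ K) q‖ ≤ DK ^ i) (y : Momentum) :
    ‖iteratedFDeriv ℝ n (fun y : Momentum => ((fun (ψ : FreqBand → ℂ) => fun x => fderiv ℝ ψ x fbE0)^[N] (uvSymbol₂ c Λ))
        (fbPt om (frameLevel μ K ((2 * π) • y)))) y‖ ≤
      n ! * (c * B * (N + n + 1) ! * (2 / max |om| (Λ / 2)) ^ (N + 2) * (max 1 (2 / max |om| (Λ / 2))) ^ (n - 1)) * ((2 * π) * DK) ^ n := by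
  set m : ℝ := max |om| (Λ / 2) with hm
  have hm0 : 0 < m := lt_max_of_lt_right (by positivity)
  set h : FreqBand → ℂ := (fun (ψ : FreqBand → ℂ) => fun x => fderiv ℝ ψ x fbE0)^[N] (uvSymbol₂ c Λ) with hh
  have hhs : ContDiff ℝ ∞ h := contDiff_iterate_freqDeriv (contDiff_uvSymbol₂ c hΛ) N
  set C : ℝ := c * B * (N + n + 1) ! * (2 / m) ^ (N + 2) * (max 1 (2 / m)) ^ (n - 1) with hCdef
  have hB0 : 0 ≤ B := zero_le_one.trans hB1
  have hC : ∀ (p : Momentum) (i : ℕ), 1 ≤ i → i ≤ n → ‖iteratedFDeriv ℝ i h (fbPt om (frameLevel μ K p))‖ ≤ C := by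
    intro p i hi1 hi
    have h1 := norm_iteratedFDeriv_iterate_freqDeriv_uvSymbol₂_le hc hΛ N i hB1 (fun j hj t => hB j (by omega) t) (fbPt om (frameLevel μ K p))
    rw [fbPt_apply_zero] at h1
    refine h1.trans ?_
    rw [hCdef]
    have hfac : ((N + i + 1) ! : ℝ) ≤ (N + n + 1) ! := by exact_mod_cast Nat.factorial_le (by omega)
    have hpow : (2 / m) ^ (N + i + 1) ≤ (2 / m) ^ (N + 2) * (max 1 (2 / m)) ^ (n - 1) := by
      obtain ⟨j, rfl⟩ : ∃ j, i = j + 1 := ⟨i - 1, by omega⟩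
      rw [show N + (j + 1) + 1 = (N + 2) + j by ring, pow_add]
      refine mul_le_mul_of_nonneg_left ?_ (by positivity)
      calc (2 / m) ^ j ≤ (max 1 (2 / m)) ^ j := pow_le_pow_left₀ (by positivity) (le_max_right _ _) j
        _ ≤ (max 1 (2 / m)) ^ (n - 1) := pow_le_pow_right₀ (le_max_left _ _) (by omega)
    calc c * B * ((N + i + 1) ! : ℝ) * (2 / m) ^ (N + i + 1) ≤ c * B * ((N + n + 1) ! : ℝ) * ((2 / m) ^ (N + 2) * (max 1 (2 / m)) ^ (n - 1)) := by
          gcongr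
      _ = C := by rw [hCdef]; ring
  have hu : ContDiff ℝ ∞ (frameLevel μ K) := contDiff_frameLevel μ K
  have hband : ∀ p : Momentum, ‖iteratedFDeriv ℝ n (fun q : Momentum => h (fbPt om (frameLevel μ K q))) p‖ ≤ n ! * C * DK ^ n :=
    fun p => norm_iteratedFDeriv_comp_band_le_of_one_le hhs hn1 (hu.of_le (by exact_mod_cast le_top)) om p (hC p) (fun i hi1 hin => hK i hi1 hin p)
  have hcd : ContDiff ℝ n (fun q : Momentum => h (fbPt om (frameLevel μ K q))) :=
    (hhs.of_le (by exact_mod_cast le_top)).comp (contDiff_fbPt_comp (hu.of_le (by exact_mod_cast le_top)) om)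
  have hcomp : (fun y : Momentum => h (fbPt om (frameLevel μ K ((2 * π) • y)))) =
      fun y : Momentum => (fun q : Momentum => h (fbPt om (frameLevel μ K q))) ((2 * π) • y) := rfl
  rw [hcomp]
  refine (norm_iteratedFDeriv_comp_smul_le hcd (2 * π) y).trans ?_
  calc |2 * π| ^ n * ‖iteratedFDeriv ℝ n (fun q : Momentum => h (fbPt om (frameLevel μ K q))) ((2 * π) • y)‖
      ≤ |2 * π| ^ n * (n ! * C * DK ^ n) := mul_le_mul_of_nonneg_left (hband _) (by positivity)
    _ = n ! * C * ((2 * π) * DK) ^ n := by rw [abs_of_pos (by positivity : (0 : ℝ) < 2 * π), mul_pow]; ring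

/-- **Bare-frame jets of the `N`-th frequency derivative of the spatial symbol, table-free**: `D_K = 4`, `B = klChi2CauchyTab (N+n)`. -/
theorem norm_iteratedFDeriv_freqDeriv_uvSpatialSymbol_bare_le_of_one_le_tab {c Λ : ℝ} (hc : 0 ≤ c) (hΛ : 0 < Λ) (μ om : ℝ) (N : ℕ) {n : ℕ}
    (hn1 : 1 ≤ n) (y : Momentum) :
    ‖iteratedFDeriv ℝ n (fun y : Momentum => ((fun (ψ : FreqBand → ℂ) => fun x => fderiv ℝ ψ x fbE0)^[N] (uvSymbol₂ c Λ))
        (fbPt om (frameLevel μ 0 ((2 * π) • y)))) y‖ ≤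
      n ! * (c * klChi2CauchyTab (N + n) * (N + n + 1) ! * (2 / max |om| (Λ / 2)) ^ (N + 2) * (max 1 (2 / max |om| (Λ / 2))) ^ (n - 1)) *
        ((2 * π) * 4) ^ n := by
  refine norm_iteratedFDeriv_freqDeriv_uvSpatialSymbol_le_of_one_le hc hΛ μ 0 om N hn1 (one_le_klChi2CauchyTab (N + n))
    (salmhoferCutoff_flat_cauchy_table_deriv (N + n)) (fun i hi1 _ q => ?_) y
  calc ‖iteratedFDeriv ℝ i (frameLevel μ 0) q‖ ≤ 4 := norm_iteratedFDeriv_frameLevel_zero_le μ hi1 q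
    _ = 4 ^ 1 := (pow_one _).symm
    _ ≤ 4 ^ i := pow_le_pow_right₀ (by norm_num) hi1


/-! ## §3 Consequence for the torus spatial factor: `∂_ωᴺ` passes inside the momentum sum, and decays off site -/

section Torus

open Literature.Analysis.FunctionSpaces UnitAddTorus
open Summit.HubbardSuperconductivity.HubbardSuperconductivity.Theorems.C4a (isLatticePeriodic_rescale frameLevel_periodic_single)

variable {L : ℕ} [NeZero L]

/-- Periodicity of the spatial function `y ↦ (TᴺΨ₂)(ω, e_K(2πy))`. -/
theorem freqDeriv_uvSpatialSymbol_isLatticePeriodic (c Λ μ : ℝ) (K : TrigPolyC4v) (om : ℝ) (N : ℕ) :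
    Torus.IsLatticePeriodic (fun y : Momentum => ((fun (ψ : FreqBand → ℂ) => fun x => fderiv ℝ ψ x fbE0)^[N] (uvSymbol₂ c Λ))
      (fbPt om (frameLevel μ K ((2 * π) • y)))) :=
  isLatticePeriodic_rescale (Φ := fun q : Momentum => ((fun (ψ : FreqBand → ℂ) => fun x => fderiv ℝ ψ x fbE0)^[N] (uvSymbol₂ c Λ))
    (fbPt om (frameLevel μ K q))) (fun j q => by simp only [frameLevel_periodic_single])

/-- Smoothness of the spatial function `y ↦ (TᴺΨ₂)(ω, e_K(2πy))` (`0 < Λ`). -/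
theorem freqDeriv_uvSpatialSymbol_contDiff (c : ℝ) {Λ : ℝ} (hΛ : 0 < Λ) (μ : ℝ) (K : TrigPolyC4v) (om : ℝ) (N : ℕ) :
    ContDiff ℝ (⊤ : ℕ∞) (fun y : Momentum => ((fun (ψ : FreqBand → ℂ) => fun x => fderiv ℝ ψ x fbE0)^[N] (uvSymbol₂ c Λ))
      (fbPt om (frameLevel μ K ((2 * π) • y)))) :=
  (contDiff_iterate_freqDeriv (contDiff_uvSymbol₂ c hΛ) N).comp
    (contDiff_fbPt_comp ((contDiff_frameLevel μ K).comp (contDiff_const_smul _)) om)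

/-- **`∂_ωᴺ` of the torus spatial factor is the momentum sum of the spatial function of `TᴺΨ₂`**: for `0 < Λ`,
`iteratedDeriv N (ω ↦ torusFourierInv (k ↦ g^c_ω(k/L)) x) ω = torusFourierInv (k ↦ (TᴺΨ₂^c)(ω, e_K(2π k/L))) x`. -/
theorem iteratedDeriv_freq_torusFourierInv_uvSpatialSample (c : ℝ) {Λ : ℝ} (hΛ : 0 < Λ) (μ : ℝ) (K : TrigPolyC4v) (N : ℕ)
    (x : TorusSite 2 L) (om : ℝ) :
    iteratedDeriv N (fun om : ℝ => torusFourierInv (fun kv : TorusSite 2 L =>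
        (fun y : Momentum => uvSymbolFn c Λ (frameLevel μ K ((2 * π) • y)) om) (WithLp.toLp 2 fun i => ((kv i).val : ℝ) / L)) x) om =
      torusFourierInv (fun kv : TorusSite 2 L =>
        (fun y : Momentum => ((fun (ψ : FreqBand → ℂ) => fun x => fderiv ℝ ψ x fbE0)^[N] (uvSymbol₂ c Λ))
          (fbPt om (frameLevel μ K ((2 * π) • y)))) (WithLp.toLp 2 fun i => ((kv i).val : ℝ) / L)) x := by
  simp only [torusFourierInv_eq_sum_torusChar]
  rw [iteratedDeriv_const_mul_field]
  congr 1
  have hline : ∀ e : ℝ, ContDiff ℝ ∞ (fun om : ℝ => fbPt om e) := fun e => by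
    show ContDiff ℝ ∞ (fun om : ℝ => om • fbE0 + e • fbE1)
    exact (contDiff_id.smul contDiff_const).add contDiff_const
  have hfun : ∀ kv : TorusSite 2 L, uvSymbolFn c Λ (frameLevel μ K ((2 * π) • (WithLp.toLp 2 fun i => ((kv i).val : ℝ) / L : Momentum))) =
      fun om : ℝ => uvSymbol₂ c Λ (fbPt om (frameLevel μ K ((2 * π) • (WithLp.toLp 2 fun i => ((kv i).val : ℝ) / L : Momentum)))) :=
    fun kv => by funext om; rw [uvSymbol₂_fbPt]
  have hsmooth : ∀ kv : TorusSite 2 L, ContDiff ℝ ∞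
      (uvSymbolFn c Λ (frameLevel μ K ((2 * π) • (WithLp.toLp 2 fun i => ((kv i).val : ℝ) / L : Momentum)))) := fun kv => by
    rw [hfun kv]
    exact (contDiff_uvSymbol₂ c hΛ).comp (hline _)
  rw [iteratedDeriv_fun_sum (fun kv _ => ((hsmooth kv).mul contDiff_const).contDiffAt.of_le (by exact_mod_cast le_top))]
  refine Finset.sum_congr rfl fun kv _ => ?_
  rw [iteratedDeriv_mul_const_field]
  congr 1
  rw [hfun kv, iteratedDeriv_comp_fbPt_eq_iterate_freqDeriv (contDiff_uvSymbol₂ c hΛ)]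

/-- **Off-site decay of `∂_ωᴺ` of the torus spatial factor, uniformly in `L`** (bare frame, table-free): for `0 ≤ c`, `0 < Λ`, `n ≥ 4`, a centred off-site
`z` (`2‖z‖_∞ ≤ L`, `z̄ ≠ 0`), every `N` and every real `ω`:
`‖∂_ωᴺ [L⁻²Σ_k χ_k(z̄) Ψ^c(ω, e_0(k))]‖ ≤ [n!·(c·klChi2CauchyTab(N+n)·(N+n+1)!·(2/m)^{N+2}·max(1,2/m)^{n−1})·(8π)ⁿ/πⁿ]·(1+4ⁿS_n)·(1+‖z‖_∞)⁻ⁿ`. -/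
theorem norm_iteratedDeriv_freq_torusFourierInv_uvSpatialSample_le_offSite_bare {c Λ : ℝ} (hc : 0 ≤ c) (hΛ : 0 < Λ) (μ : ℝ) (N : ℕ)
    {n : ℕ} (hn : 2 * 2 ≤ n) {z : Site 2} (hz : 2 * ‖z‖ ≤ L) (hz0 : Torus.proj L z ≠ 0) (om : ℝ) :
    ‖iteratedDeriv N (fun om : ℝ => torusFourierInv (fun kv : TorusSite 2 L =>
        (fun y : Momentum => uvSymbolFn c Λ (frameLevel μ 0 ((2 * π) • y)) om) (WithLp.toLp 2 fun i => ((kv i).val : ℝ) / L)) (Torus.proj L z)) om‖ ≤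
      (n ! * (c * klChi2CauchyTab (N + n) * (N + n + 1) ! * (2 / max |om| (Λ / 2)) ^ (N + 2) * (max 1 (2 / max |om| (Λ / 2))) ^ (n - 1)) *
          ((2 * π) * 4) ^ n) / Real.pi ^ n * (1 + (4 : ℝ) ^ n * ∑' k : Site 2, ((1 + ‖k‖) ^ n)⁻¹) * ((1 + ‖z‖) ^ n)⁻¹ := by
  rw [iteratedDeriv_freq_torusFourierInv_uvSpatialSample c hΛ μ 0 N (Torus.proj L z) om]
  exact norm_torusFourierInv_smoothSample_le_inv_pow_offSite (freqDeriv_uvSpatialSymbol_isLatticePeriodic c Λ μ 0 om N)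
    (freqDeriv_uvSpatialSymbol_contDiff c hΛ μ 0 om N) hn
    (norm_iteratedFDeriv_freqDeriv_uvSpatialSymbol_bare_le_of_one_le_tab hc hΛ μ om N (by omega)) hz hz0

end Torus

end Summit.HubbardSuperconductivity.HubbardSuperconductivity.Theorems.KLRegimeSplit

end
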